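import Literature.MathematicalPhysics.QuantumLattice.FermiRG.Salmhofer1998Sec2
import Literature.MathematicalPhysics.QuantumLattice.GramDeterminantBound
import HarnessLib

/-!
# Salmhofer 1998, Lemma 2 (the Gram bound for the covariance (4.6)) — PROOF

M. Salmhofer, *Continuous renormalization for fermions and Fermi liquid theory*, Commun. Math. Phys.
**194** (1998) 249–295 = arXiv:cond-mat/9706188 [Salmhofer1998], Lemma 2 (render
`paper:arxiv-cond-mat_9706188` p.14 L126–142, proof L144–197).  This file DISCHARGES the named fact
`Literature.MathematicalPhysics.QuantumLattice.FermiRG.Salmhofer1998.CovarianceGramBound` (licence F-080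
of the gate-hubbard-kl wave, typed by t7 in `Salmhofer1998Sec2.lean`):

`theorem CovarianceGramBound_holds : CovarianceGramBound`.

We follow the printed proof.  (i) Antisymmetry `D_t(X',X) = -D_t(X,X')`: "since `Λ* = -Λ*` and
`(-1)^j = -(-1)^{j'}`, a change of variables `k → (-1)^j k`" plus the symmetry of `M` (p.14 L144–152) —
here the reindexing by the involution `neg` of `DForm`, `χ_{neg k} = conj χ_k` and `χ_k(-x) = conj χ_k(x)`.
(ii) The Gram bound: `D_t(Y_k, Z_l) = ⟨a(Y_k), b(Z_l)⟩` for vectors in `ℓ²(Λ* × N × {1,2})` with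
`‖a‖², ‖b‖² ≤ ∫dk |D̂(k)|` (p.14 L153–197, (4.11)–(4.13)), then Gram's inequality — the tree's
`Literature.Analysis.InnerProduct.norm_det_inner_le_prod_norm_mul_prod_norm` (Gram–Hadamard), exactly as
in the tree's `norm_det_momentumKernel_le` (GramDeterminantBound.lean) for the spinless torus kernel.
ONE DEVIATION from the printed road, shorter in Lean: instead of the spectral decomposition
`M = Σ_ρ m_ρ P_ρ` (p.14 L153–158) we put the spin matrix entirely into the second Gram vector,
`b ∝ M(k) e_{σ'}`, and bound `‖M(k) e_{σ'}‖ ≤ 1` by the elementary polarisation argument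
`‖Mv‖² ≤ ‖v‖²` for a symmetric `M` with `|⟨v, Mv⟩| ≤ ⟨v, v⟩` (`dotProduct_mulVec_self_le`), which is
all that (4.13) uses of the eigenvalue condition `|m_ρ| ≤ 1`.

No new definition of mathematical content (the two Gram vectors are proof devices), no `sorry`, no new
named fact: net fact debt `-1`.
-/

noncomputable section

open Finset Matrix
open scoped InnerProductSpace ComplexConjugate

namespace Literature.MathematicalPhysics.QuantumLattice.FermiRG

namespace Salmhofer1998

/-! ### Unimodular multiplicative characters -/

section Characters

variable {Λ : Type*} [AddCommGroup Λ] {Λs : Type*} (χ : Λs → Λ → ℂ)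

/-- `χ_k(0) = 1`. [cite: Salmhofer1998, Lemma 2 proof (p.14 L144–152)] -/
theorem char_zero (hadd : ∀ (k : Λs) (x y : Λ), χ k (x + y) = χ k x * χ k y)
    (hnorm : ∀ (k : Λs) (x : Λ), ‖χ k x‖ = 1) (k : Λs) : χ k 0 = 1 := by
  have hne : χ k 0 ≠ 0 := by
    intro h0
    have h1 := hnorm k 0
    rw [h0, norm_zero] at h1
    exact zero_ne_one h1
  have h := hadd k 0 0
  rw [add_zero] at h
  -- `1 * χ0 = χ0 * χ0`
  have h' : (1 : ℂ) * χ k 0 = χ k 0 * χ k 0 := by rw [one_mul]; exact h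
  exact (mul_right_cancel₀ hne h').symm

/-- `χ_k(-x) = conj χ_k(x)` for a unimodular multiplicative character.
[cite: Salmhofer1998, Lemma 2 proof (p.14 L144–152)] -/
theorem char_neg_arg (hadd : ∀ (k : Λs) (x y : Λ), χ k (x + y) = χ k x * χ k y)
    (hnorm : ∀ (k : Λs) (x : Λ), ‖χ k x‖ = 1) (k : Λs) (x : Λ) : χ k (-x) = conj (χ k x) := by
  have hne : χ k x ≠ 0 := by
    intro h0
    have h1 := hnorm k x
    rw [h0, norm_zero] at h1
    exact zero_ne_one h1
  have h1 : χ k x * χ k (-x) = 1 := by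
    rw [← hadd, add_neg_cancel, char_zero χ hadd hnorm]
  have h2 : χ k x * conj (χ k x) = 1 := by
    rw [Complex.mul_conj, Complex.normSq_eq_norm_sq, hnorm k x]
    norm_num
  exact mul_left_cancel₀ hne (h1.trans h2.symm)

/-- `χ_k(x - y) = χ_k(x) conj χ_k(y)`. [cite: Salmhofer1998, Lemma 2 proof (p.14 L144–152)] -/
theorem char_sub (hadd : ∀ (k : Λs) (x y : Λ), χ k (x + y) = χ k x * χ k y)
    (hnorm : ∀ (k : Λs) (x : Λ), ‖χ k x‖ = 1) (k : Λs) (x y : Λ) :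
    χ k (x - y) = χ k x * conj (χ k y) := by
  rw [sub_eq_add_neg, hadd, char_neg_arg χ hadd hnorm]

end Characters

/-! ### The contraction lemma for a symmetric matrix with `|⟨v, Mv⟩| ≤ ⟨v, v⟩` -/

section Contraction

variable {N : Type*} [Fintype N]

/-- For a real symmetric matrix `M` with `|v ⬝ Mv| ≤ v ⬝ v` for all `v` (all eigenvalues in `[-1, 1]`,
Lemma 2's hypothesis on `M(k)`), `‖Mv‖² ≤ ‖v‖²` — by polarisation with `u = Mv`:
`4 (Mv ⬝ Mv) = (Mv+v) ⬝ M(Mv+v) - (Mv-v) ⬝ M(Mv-v) ≤ |Mv+v|² + |Mv-v|² = 2|Mv|² + 2|v|²`.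
(Replaces the spectral decomposition of the printed proof, p.14 L153–158.)
[cite: Salmhofer1998, Lemma 2 proof (p.14 L153–197)] -/
theorem dotProduct_mulVec_self_le (M : Matrix N N ℝ) (hM : M.IsSymm)
    (hc : ∀ v : N → ℝ, |v ⬝ᵥ M *ᵥ v| ≤ v ⬝ᵥ v) (v : N → ℝ) :
    (M *ᵥ v) ⬝ᵥ (M *ᵥ v) ≤ v ⬝ᵥ v := by
  have hsym : ∀ a b : N → ℝ, a ⬝ᵥ M *ᵥ b = b ⬝ᵥ M *ᵥ a := by
    intro a b
    rw [Matrix.dotProduct_mulVec, ← Matrix.mulVec_transpose, hM.eq, dotProduct_comm]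
  have h1 := (abs_le.mp (hc (M *ᵥ v + v))).2
  have h2 := (abs_le.mp (hc (M *ᵥ v - v))).1
  have e1 : (M *ᵥ v + v) ⬝ᵥ M *ᵥ (M *ᵥ v + v) =
      (M *ᵥ v) ⬝ᵥ M *ᵥ (M *ᵥ v) + 2 * ((M *ᵥ v) ⬝ᵥ (M *ᵥ v)) + v ⬝ᵥ M *ᵥ v := by
    rw [Matrix.mulVec_add, add_dotProduct, dotProduct_add, dotProduct_add, hsym v (M *ᵥ v)]
    ring
  have e2 : (M *ᵥ v - v) ⬝ᵥ M *ᵥ (M *ᵥ v - v) =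
      (M *ᵥ v) ⬝ᵥ M *ᵥ (M *ᵥ v) - 2 * ((M *ᵥ v) ⬝ᵥ (M *ᵥ v)) + v ⬝ᵥ M *ᵥ v := by
    rw [Matrix.mulVec_sub, sub_dotProduct, dotProduct_sub, dotProduct_sub, hsym v (M *ᵥ v)]
    ring
  have e3 : (M *ᵥ v + v) ⬝ᵥ (M *ᵥ v + v) =
      (M *ᵥ v) ⬝ᵥ (M *ᵥ v) + 2 * ((M *ᵥ v) ⬝ᵥ v) + v ⬝ᵥ v := by
    rw [add_dotProduct, dotProduct_add, dotProduct_add, dotProduct_comm v (M *ᵥ v)]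
    ring
  have e4 : (M *ᵥ v - v) ⬝ᵥ (M *ᵥ v - v) =
      (M *ᵥ v) ⬝ᵥ (M *ᵥ v) - 2 * ((M *ᵥ v) ⬝ᵥ v) + v ⬝ᵥ v := by
    rw [sub_dotProduct, dotProduct_sub, dotProduct_sub, dotProduct_comm v (M *ᵥ v)]
    ring
  rw [e1, e3] at h1
  rw [e2, e4] at h2
  linarith

/-- Consequence: every column of such an `M` has Euclidean length `≤ 1`, `Σ_τ M_{τσ}² ≤ 1` ((4.13) of the
printed proof: `Σ_ρ |m_ρ(k)|² ⟨e_σ, P_ρ(k) e_σ⟩ ≤ 1`). [cite: Salmhofer1998, Lemma 2 proof (4.13) (p.14 L190–195)] -/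
theorem sum_sq_col_le_one [DecidableEq N] (M : Matrix N N ℝ) (hM : M.IsSymm)
    (hc : ∀ v : N → ℝ, |v ⬝ᵥ M *ᵥ v| ≤ v ⬝ᵥ v) (σ : N) : ∑ τ, M τ σ ^ 2 ≤ 1 := by
  let e : N → ℝ := fun τ => if τ = σ then 1 else 0
  have hMe : M *ᵥ e = fun τ => M τ σ := by
    funext τ
    simp only [Matrix.mulVec, dotProduct, e, mul_ite, mul_one, mul_zero, Finset.sum_ite_eq',
      Finset.mem_univ, if_true]
  have hee : e ⬝ᵥ e = 1 := by
    simp only [dotProduct, e, mul_ite, mul_one, mul_zero, Finset.sum_ite_eq', Finset.mem_univ, if_true]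
  have h := dotProduct_mulVec_self_le M hM hc e
  rw [hMe, hee] at h
  calc ∑ τ, M τ σ ^ 2 = ∑ τ, M τ σ * M τ σ := by simp [sq]
    _ ≤ 1 := h

end Contraction

/-! ### The Gram vectors for the covariance (4.6) (proof devices; no instances needed) -/

section GramDefs

variable {Λ Λs N : Type}

/-- The weight `ρ_t(k) = √(ε_* |D̂_t(k)|)`. [cite: Salmhofer1998, Lemma 2 proof (4.11) (p.14 L170–180)] -/
def gramWeight (εs : ℝ) (Dhat : ℝ → Λs → ℂ) (t : ℝ) (k : Λs) : ℝ :=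
  Real.sqrt ‖((εs : ℂ) * Dhat t k)‖

/-- The phase-carrying factor `φ_t(k) = ε_* D̂_t(k) / ρ_t(k)` (so `ρ φ = ε_* D̂`, `|φ| ≤ ρ`).
[cite: Salmhofer1998, Lemma 2 proof (4.11) (p.14 L170–180)] -/
def gramPhase (εs : ℝ) (Dhat : ℝ → Λs → ℂ) (t : ℝ) (k : Λs) : ℂ :=
  ((εs : ℂ) * Dhat t k) / ((gramWeight εs Dhat t k : ℝ) : ℂ)

/-- `ρ φ = ε_* D̂`. [cite: Salmhofer1998, Lemma 2 proof (4.11) (p.14 L170–180)] -/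
theorem gramWeight_mul_gramPhase (εs : ℝ) (Dhat : ℝ → Λs → ℂ) (t : ℝ) (k : Λs) :
    ((gramWeight εs Dhat t k : ℝ) : ℂ) * gramPhase εs Dhat t k = (εs : ℂ) * Dhat t k :=
  sqrt_norm_mul_div_sqrt_norm _

/-- `|φ| ≤ ρ`. [cite: Salmhofer1998, Lemma 2 proof (4.11) (p.14 L170–180)] -/
theorem norm_gramPhase_le (εs : ℝ) (Dhat : ℝ → Λs → ℂ) (t : ℝ) (k : Λs) :
    ‖gramPhase εs Dhat t k‖ ≤ gramWeight εs Dhat t k :=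
  norm_div_sqrt_norm_le _

/-- `ρ ≥ 0`. [cite: Salmhofer1998, Lemma 2 proof (4.11) (p.14 L170–180)] -/
theorem gramWeight_nonneg (εs : ℝ) (Dhat : ℝ → Λs → ℂ) (t : ℝ) (k : Λs) :
    0 ≤ gramWeight εs Dhat t k := Real.sqrt_nonneg _

/-- `ρ² = ε_* |D̂|`. [cite: Salmhofer1998, Lemma 2 proof (4.11) (p.14 L170–180)] -/
theorem gramWeight_sq {εs : ℝ} (hε : 0 < εs) (Dhat : ℝ → Λs → ℂ) (t : ℝ) (k : Λs) :
    gramWeight εs Dhat t k ^ 2 = εs * ‖Dhat t k‖ := by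
  rw [gramWeight, Real.sq_sqrt (norm_nonneg _), norm_mul, Complex.norm_real, Real.norm_of_nonneg hε.le]

/-- `|φ|² ≤ ε_* |D̂|`. [cite: Salmhofer1998, Lemma 2 proof (4.11) (p.14 L170–180)] -/
theorem norm_gramPhase_sq_le {εs : ℝ} (hε : 0 < εs) (Dhat : ℝ → Λs → ℂ) (t : ℝ) (k : Λs) :
    ‖gramPhase εs Dhat t k‖ ^ 2 ≤ εs * ‖Dhat t k‖ := by
  rw [← gramWeight_sq hε Dhat t k]
  exact pow_le_pow_left₀ (norm_nonneg _) (norm_gramPhase_le εs Dhat t k) 2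

/-- The first Gram vector `a(X)`, `X = (x, σ, j)`, supported on the block `c = j`, `τ = σ` of
`ℓ²(Λ* × N × {1,2})`: `χ_k(x)` (resp. its conjugate on the block `j ↦ 2`) times `ρ(k)`.
[cite: Salmhofer1998, Lemma 2 proof (4.9)–(4.11) (p.14 L160–180)] -/
def gramA [DecidableEq N] (χ : Λs → Λ → ℂ) (εs : ℝ) (Dhat : ℝ → Λs → ℂ) (t : ℝ) (X : Λ × N × Fin 2) :
    EuclideanSpace ℂ (Λs × N × Fin 2) :=
  WithLp.toLp 2 fun i =>
    if i.2.2 = X.2.2 ∧ i.2.1 = X.2.1 then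
      (if X.2.2 = 1 then conj (χ i.1 X.1) else χ i.1 X.1) * ((gramWeight εs Dhat t i.1 : ℝ) : ℂ)
    else 0

/-- The second Gram vector `b(X')`, `X' = (x', σ', j')`, supported on the block `c ≠ j'`: the character
(conjugated on the block `c ↦ 2`, with the sign `-` on the block `c ↦ 1`) times `φ(k) M(k)_{τσ'}`.
[cite: Salmhofer1998, Lemma 2 proof (4.9)–(4.11) (p.14 L160–180)] -/
def gramB (χ : Λs → Λ → ℂ) (εs : ℝ) (Dhat : ℝ → Λs → ℂ) (M : Λs → Matrix N N ℝ) (t : ℝ)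
    (X : Λ × N × Fin 2) : EuclideanSpace ℂ (Λs × N × Fin 2) :=
  WithLp.toLp 2 fun i =>
    if i.2.2 ≠ X.2.2 then
      (if i.2.2 = 1 then conj (χ i.1 X.1) * gramPhase εs Dhat t i.1
        else -(χ i.1 X.1 * gramPhase εs Dhat t i.1)) * ((M i.1 i.2.1 X.2.1 : ℝ) : ℂ)
    else 0

variable {χ : Λs → Λ → ℂ} {neg : Λs → Λs} {εs : ℝ} {Dhat : ℝ → Λs → ℂ} {M : Λs → Matrix N N ℝ}

/-- Components of `a(X)`. [cite: Salmhofer1998, Lemma 2 proof (4.9)–(4.11) (p.14 L160–180)] -/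
theorem gramA_apply [DecidableEq N] (t : ℝ) (x : Λ) (σ : N) (j : Fin 2) (k : Λs) (τ : N) (c : Fin 2) :
    gramA χ εs Dhat t (x, σ, j) (k, τ, c) =
      if c = j ∧ τ = σ then
        (if j = 1 then conj (χ k x) else χ k x) * ((gramWeight εs Dhat t k : ℝ) : ℂ)
      else 0 := rfl

/-- The component of `a(x, σ, j)` at `(k, σ, j)`. [cite: Salmhofer1998, Lemma 2 proof (4.11) (p.14 L170–180)] -/
theorem gramA_apply_diag [DecidableEq N] (t : ℝ) (x : Λ) (σ : N) (j : Fin 2) (k : Λs) :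
    gramA χ εs Dhat t (x, σ, j) (k, σ, j) =
      (if j = 1 then conj (χ k x) else χ k x) * ((gramWeight εs Dhat t k : ℝ) : ℂ) := by
  rw [gramA_apply, if_pos ⟨rfl, rfl⟩]

/-- `a(x, σ, j)` vanishes off the block `(·, σ, j)`. [cite: Salmhofer1998, Lemma 2 proof (4.11) (p.14 L170–180)] -/
theorem gramA_apply_of_ne [DecidableEq N] (t : ℝ) (x : Λ) (σ : N) (j : Fin 2) (k : Λs) {τ : N}
    {c : Fin 2} (h : (τ, c) ≠ (σ, j)) : gramA χ εs Dhat t (x, σ, j) (k, τ, c) = 0 := by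
  rw [gramA_apply, if_neg]
  rintro ⟨hc, hτ⟩
  exact h (Prod.ext hτ hc)

/-- Components of `b(X')`. [cite: Salmhofer1998, Lemma 2 proof (4.9)–(4.11) (p.14 L160–180)] -/
theorem gramB_apply (t : ℝ) (x' : Λ) (σ' : N) (j' : Fin 2) (k : Λs) (τ : N) (c : Fin 2) :
    gramB χ εs Dhat M t (x', σ', j') (k, τ, c) =
      if c ≠ j' then
        (if c = 1 then conj (χ k x') * gramPhase εs Dhat t k else -(χ k x' * gramPhase εs Dhat t k)) *
          ((M k τ σ' : ℝ) : ℂ)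
      else 0 := rfl

/-- The components of `b(x', σ', j')` on the block `c ≠ j'`. [cite: Salmhofer1998, Lemma 2 proof (4.11) (p.14 L170–180)] -/
theorem gramB_apply_of_ne (t : ℝ) (x' : Λ) (σ' τ : N) {j' c : Fin 2} (h : c ≠ j') (k : Λs) :
    gramB χ εs Dhat M t (x', σ', j') (k, τ, c) =
      (if c = 1 then conj (χ k x') * gramPhase εs Dhat t k else -(χ k x' * gramPhase εs Dhat t k)) *
        ((M k τ σ' : ℝ) : ℂ) := by
  rw [gramB_apply, if_pos h]

/-- `b(x', σ', j')` vanishes on the block `c = j'` (this is the `δ_{j', 3-j}` of (4.6)).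
[cite: Salmhofer1998, Lemma 2 (4.6) (p.14 L131–135)] -/
theorem gramB_apply_of_eq (t : ℝ) (x' : Λ) (σ' τ : N) (j' : Fin 2) (k : Λs) :
    gramB χ εs Dhat M t (x', σ', j') (k, τ, j') = 0 := by
  rw [gramB_apply, if_neg (not_not.mpr rfl)]

/-- Reindexing a sum over `Λ*` by the involution `neg`. [cite: Salmhofer1998, Lemma 2 proof (p.14 L144–146)] -/
theorem sum_comp_neg [Fintype Λs] (hinv : ∀ k : Λs, neg (neg k) = k) (F : Λs → ℂ) :
    ∑ k, F (neg k) = ∑ k, F k :=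
  Fintype.sum_equiv (Function.Involutive.toPerm neg hinv) (fun k => F (neg k)) F fun _ => rfl

/-- The `(4.6)`-sum for `j ↦ 2` (printed `j = 2`): no reindexing, the sign is `+`.
[cite: Salmhofer1998, Lemma 2 proof (p.14 L144–150)] -/
theorem sum_form_one [Fintype Λs] (t : ℝ) (y : Λ) (σ σ' : N) :
    (∑ k, χ k y * (-1 : ℂ) ^ ((1 : Fin 2).val + 1) * Dhat t (if (1 : Fin 2) = 0 then neg k else k) *
        ((M (if (1 : Fin 2) = 0 then neg k else k) σ σ' : ℝ) : ℂ)) =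
      ∑ k, χ k y * Dhat t k * ((M k σ σ' : ℝ) : ℂ) := by
  refine Finset.sum_congr rfl fun k _ => ?_
  have h10 : (1 : Fin 2) ≠ 0 := by decide
  rw [if_neg h10, Fin.val_one]
  ring

end GramDefs

/-! ### The inner products and norms of the Gram vectors; Lemma 2 -/

section Gram

variable {Λ : Type} [AddCommGroup Λ] [Fintype Λ] {Λs N : Type} [Fintype Λs] [Fintype N] [DecidableEq N]
  {χ : Λs → Λ → ℂ} {neg : Λs → Λs} {εs : ℝ} {Dhat : ℝ → Λs → ℂ} {M : Λs → Matrix N N ℝ}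
  {D : ℝ → (Λ × N × Fin 2) → (Λ × N × Fin 2) → ℂ}

omit [DecidableEq N] in
/-- The `(4.6)`-sum for `j ↦ 1` (printed `j = 1`), reindexed by `k ↦ -k`:
`Σ_k χ_k(y) D̂(-k) M(-k) = Σ_k conj χ_k(y) D̂(k) M(k)` (with its sign `(-1)^1`).
[cite: Salmhofer1998, Lemma 2 proof (p.14 L144–150)] -/
theorem sum_form_zero_reindex (hD : DForm Λ Λs N χ neg εs Dhat M D) (t : ℝ) (y : Λ) (σ σ' : N) :
    (∑ k, χ k y * (-1 : ℂ) ^ ((0 : Fin 2).val + 1) * Dhat t (if (0 : Fin 2) = 0 then neg k else k) *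
        ((M (if (0 : Fin 2) = 0 then neg k else k) σ σ' : ℝ) : ℂ)) =
      ∑ k, -(conj (χ k y) * Dhat t k * ((M k σ σ' : ℝ) : ℂ)) := by
  rw [← sum_comp_neg hD.neg_invol (fun k => -(conj (χ k y) * Dhat t k * ((M k σ σ' : ℝ) : ℂ)))]
  refine Finset.sum_congr rfl fun k _ => ?_
  rw [if_pos rfl, hD.char_neg, Complex.conj_conj, Fin.val_zero, zero_add, pow_one]
  ring

/-- `⟨a(X), b(X')⟩ = D_t(X, X')` for the covariance of the form (4.6).
[cite: Salmhofer1998, Lemma 2 proof (4.9) (p.14 L160–168)] -/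
theorem inner_gramA_gramB (hD : DForm Λ Λs N χ neg εs Dhat M D) (t : ℝ) (X X' : Λ × N × Fin 2) :
    ⟪gramA χ εs Dhat t X, gramB χ εs Dhat M t X'⟫_ℂ = D t X X' := by
  obtain ⟨x, σ, j⟩ := X
  obtain ⟨x', σ', j'⟩ := X'
  rw [PiLp.inner_apply, Fintype.sum_prod_type]
  have hcol : ∀ k : Λs,
      (∑ τc : N × Fin 2, ⟪gramA χ εs Dhat t (x, σ, j) (k, τc), gramB χ εs Dhat M t (x', σ', j') (k, τc)⟫_ℂ) =
        ⟪gramA χ εs Dhat t (x, σ, j) (k, σ, j), gramB χ εs Dhat M t (x', σ', j') (k, σ, j)⟫_ℂ := by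
    intro k
    refine Fintype.sum_eq_single (σ, j) fun τc hτc => ?_
    obtain ⟨τ, c⟩ := τc
    rw [gramA_apply_of_ne t x σ j k hτc, inner_zero_left]
  simp only [hcol]
  simp only [RCLike.inner_apply, gramA_apply_diag]
  have hcs := char_sub χ hD.char_add hD.char_norm
  have hw := fun k => gramWeight_mul_gramPhase εs Dhat t k
  by_cases hjj : j' = j
  · -- the diagonal blocks vanish
    subst hjj
    rw [hD.form, if_neg (not_not.mpr rfl)]
    simp [gramB_apply_of_eq]
  · rw [hD.form, if_pos hjj]
    obtain rfl | rfl : j = 0 ∨ j = 1 := by fin_cases j <;> simp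
    · -- j ↦ 1 (printed j = 1), hence j' ↦ 2
      obtain rfl : j' = 1 := by fin_cases j' <;> simp_all
      have h01 : (0 : Fin 2) ≠ 1 := by decide
      rw [sum_form_zero_reindex hD, Finset.mul_sum]
      refine Finset.sum_congr rfl fun k _ => ?_
      rw [gramB_apply_of_ne t x' σ' σ h01, if_neg h01, if_neg h01, map_mul, Complex.conj_ofReal, hcs,
        map_mul, Complex.conj_conj]
      linear_combination (χ k x' * conj (χ k x) * ((M k σ σ' : ℝ) : ℂ)) * (hw k).symm
    · -- j ↦ 2 (printed j = 2), hence j' ↦ 1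
      obtain rfl : j' = 0 := by fin_cases j' <;> simp_all
      have h10 : (1 : Fin 2) ≠ 0 := by decide
      rw [sum_form_one, Finset.mul_sum]
      refine Finset.sum_congr rfl fun k _ => ?_
      rw [gramB_apply_of_ne t x' σ' σ h10, if_pos rfl, if_pos rfl, map_mul, Complex.conj_ofReal, hcs,
        Complex.conj_conj]
      linear_combination (χ k x * conj (χ k x') * ((M k σ σ' : ℝ) : ℂ)) * hw k

/-- `‖a(X)‖ ≤ (ε_* Σ_k |D̂_t(k)|)^{1/2}` ((4.12)). [cite: Salmhofer1998, Lemma 2 proof (4.12) (p.14 L181–188)] -/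
theorem norm_gramA_le (hD : DForm Λ Λs N χ neg εs Dhat M D) (t : ℝ) (X : Λ × N × Fin 2) :
    ‖gramA χ εs Dhat t X‖ ≤ Real.sqrt (εs * ∑ k, ‖Dhat t k‖) := by
  obtain ⟨x, σ, j⟩ := X
  rw [← Real.sqrt_sq (norm_nonneg (gramA χ εs Dhat t _)), EuclideanSpace.norm_sq_eq]
  refine Real.sqrt_le_sqrt (le_of_eq ?_)
  rw [Fintype.sum_prod_type, Finset.mul_sum]
  refine Finset.sum_congr rfl fun k _ => ?_
  have hcol : (∑ τc : N × Fin 2, ‖gramA χ εs Dhat t (x, σ, j) (k, τc)‖ ^ 2) =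
      ‖gramA χ εs Dhat t (x, σ, j) (k, σ, j)‖ ^ 2 := by
    refine Fintype.sum_eq_single (σ, j) fun τc hτc => ?_
    obtain ⟨τ, c⟩ := τc
    rw [gramA_apply_of_ne t x σ j k hτc, norm_zero]
    simp
  rw [hcol, gramA_apply_diag, norm_mul, Complex.norm_real, Real.norm_of_nonneg (gramWeight_nonneg εs Dhat t k),
    mul_pow, gramWeight_sq hD.εs_pos Dhat]
  have h1 : ‖(if j = 1 then conj (χ k x) else χ k x)‖ = 1 := by
    split_ifs
    · rw [RCLike.norm_conj]; exact hD.char_norm k x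
    · exact hD.char_norm k x
  rw [h1, one_pow, one_mul]

/-- `‖b(X')‖ ≤ (ε_* Σ_k |D̂_t(k)|)^{1/2}` ((4.12)–(4.13), using `Σ_τ M_{τσ'}² ≤ 1`).
[cite: Salmhofer1998, Lemma 2 proof (4.12)–(4.13) (p.14 L181–197)] -/
theorem norm_gramB_le (hD : DForm Λ Λs N χ neg εs Dhat M D) (t : ℝ) (X : Λ × N × Fin 2) :
    ‖gramB χ εs Dhat M t X‖ ≤ Real.sqrt (εs * ∑ k, ‖Dhat t k‖) := by
  obtain ⟨x, σ, j⟩ := X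
  rw [← Real.sqrt_sq (norm_nonneg (gramB χ εs Dhat M t _)), EuclideanSpace.norm_sq_eq]
  refine Real.sqrt_le_sqrt ?_
  rw [Fintype.sum_prod_type, Finset.mul_sum]
  refine Finset.sum_le_sum fun k _ => ?_
  rw [Fintype.sum_prod_type]
  -- the block `c ≠ j`: one value of `c` contributes, with `|χ| = 1`, `|φ|² ≤ ε_* |D̂|`
  have hblock : ∀ (τ : N) {c : Fin 2}, c ≠ j →
      ‖gramB χ εs Dhat M t (x, σ, j) (k, τ, c)‖ ^ 2 ≤ εs * ‖Dhat t k‖ * M k τ σ ^ 2 := by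
    intro τ c hc
    rw [gramB_apply_of_ne t x σ τ hc, norm_mul, Complex.norm_real, mul_pow, Real.norm_eq_abs, sq_abs]
    refine mul_le_mul_of_nonneg_right ?_ (sq_nonneg _)
    have hφ : ‖(if c = 1 then conj (χ k x) * gramPhase εs Dhat t k
        else -(χ k x * gramPhase εs Dhat t k))‖ = ‖gramPhase εs Dhat t k‖ := by
      split_ifs
      · rw [norm_mul, RCLike.norm_conj, hD.char_norm, one_mul]
      · rw [norm_neg, norm_mul, hD.char_norm, one_mul]
    rw [hφ]
    exact norm_gramPhase_sq_le hD.εs_pos Dhat t k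
  have hpair : ∀ τ : N, (∑ c : Fin 2, ‖gramB χ εs Dhat M t (x, σ, j) (k, τ, c)‖ ^ 2) ≤
      εs * ‖Dhat t k‖ * M k τ σ ^ 2 := by
    intro τ
    rw [Fin.sum_univ_two]
    obtain rfl | rfl : j = 0 ∨ j = 1 := by fin_cases j <;> simp
    · rw [gramB_apply_of_eq, norm_zero, zero_pow two_ne_zero, zero_add]
      exact hblock τ (by decide)
    · rw [gramB_apply_of_eq, norm_zero, zero_pow two_ne_zero, add_zero]
      exact hblock τ (by decide)
  calc ∑ τ, ∑ c, ‖gramB χ εs Dhat M t (x, σ, j) (k, τ, c)‖ ^ 2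
      ≤ ∑ τ, εs * ‖Dhat t k‖ * M k τ σ ^ 2 := Finset.sum_le_sum fun τ _ => hpair τ
    _ = εs * ‖Dhat t k‖ * ∑ τ, M k τ σ ^ 2 := by rw [Finset.mul_sum]
    _ ≤ εs * ‖Dhat t k‖ * 1 := by
        refine mul_le_mul_of_nonneg_left ?_ (mul_nonneg hD.εs_pos.le (norm_nonneg _))
        exact sum_sq_col_le_one (M k) (hD.symm_M k) (hD.contraction_M k) σ
    _ = εs * ‖Dhat t k‖ := mul_one _

omit [DecidableEq N] in
/-- **Antisymmetry** `D_t(X', X) = -D_t(X, X')` of the covariance (4.6) (first half of Lemma 2).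
[cite: Salmhofer1998, Lemma 2 (p.14 L137, proof L144–152)] -/
theorem dform_antisymm (hD : DForm Λ Λs N χ neg εs Dhat M D) (t : ℝ) (X X' : Λ × N × Fin 2) :
    D t X' X = -D t X X' := by
  obtain ⟨x, σ, j⟩ := X
  obtain ⟨x', σ', j'⟩ := X'
  have hMs : ∀ k, M k σ' σ = M k σ σ' := fun k => (hD.symm_M k).apply σ σ'
  -- `conj χ_k(x - x') = χ_k(x' - x)` and symmetrically
  have hcn : ∀ k, conj (χ k (x - x')) = χ k (x' - x) := by
    intro k
    rw [← neg_sub x' x, char_neg_arg χ hD.char_add hD.char_norm, Complex.conj_conj]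
  have hcn' : ∀ k, conj (χ k (x' - x)) = χ k (x - x') := by
    intro k
    rw [← neg_sub x x', char_neg_arg χ hD.char_add hD.char_norm, Complex.conj_conj]
  by_cases hjj : j' = j
  · subst hjj
    rw [hD.form, hD.form, if_neg (not_not.mpr rfl), if_neg (not_not.mpr rfl), neg_zero]
  · have hjj' : j ≠ j' := fun h => hjj h.symm
    rw [hD.form, hD.form, if_pos hjj', if_pos hjj]
    obtain rfl | rfl : j = 0 ∨ j = 1 := by fin_cases j <;> simp
    · obtain rfl : j' = 1 := by fin_cases j' <;> simp_all
      rw [sum_form_one, sum_form_zero_reindex hD, Finset.sum_neg_distrib, mul_neg, neg_neg]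
      congr 1
      refine Finset.sum_congr rfl fun k _ => ?_
      rw [hcn k, hMs k]
    · obtain rfl : j' = 0 := by fin_cases j' <;> simp_all
      rw [sum_form_one, sum_form_zero_reindex hD, Finset.sum_neg_distrib, mul_neg]
      congr 2
      refine Finset.sum_congr rfl fun k _ => ?_
      rw [hcn' k, hMs k]

/-- **The Gram bound** `|det 𝒟_t^{(m)}(Y, Z)| ≤ (ε_* Σ_k |D̂_t(k)|)^m` for the covariance (4.6) (second
half of Lemma 2, with `m = i - 1`). [cite: Salmhofer1998, Lemma 2 (4.8) (p.14 L139–142)] -/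
theorem norm_det_covMatrix_le (hD : DForm Λ Λs N χ neg εs Dhat M D) (t : ℝ) {m : ℕ}
    (Y Z : Fin m → Λ × N × Fin 2) :
    ‖(covMatrix (D t) Y Z).det‖ ≤ (εs * ∑ k, ‖Dhat t k‖) ^ m := by
  set S := εs * ∑ k, ‖Dhat t k‖ with hSdef
  have hS : 0 ≤ S := mul_nonneg hD.εs_pos.le (Finset.sum_nonneg fun _ _ => norm_nonneg _)
  let u : Fin m → EuclideanSpace ℂ (Λs × N × Fin 2) := fun a => gramA χ εs Dhat t (Y a)
  let v : Fin m → EuclideanSpace ℂ (Λs × N × Fin 2) := fun b => gramB χ εs Dhat M t (Z b)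
  have hM : covMatrix (D t) Y Z = Matrix.of fun a b => ⟪u a, v b⟫_ℂ := by
    ext a b
    rw [covMatrix, Matrix.of_apply, Matrix.of_apply, inner_gramA_gramB hD]
  rw [hM]
  refine (Literature.Analysis.InnerProduct.norm_det_inner_le_prod_norm_mul_prod_norm u v).trans ?_
  have h1 : ∏ a, ‖u a‖ ≤ Real.sqrt S ^ m := by
    calc ∏ a, ‖u a‖ ≤ ∏ _a : Fin m, Real.sqrt S :=
          Finset.prod_le_prod (fun _ _ => norm_nonneg _) fun a _ => norm_gramA_le hD t (Y a)
      _ = Real.sqrt S ^ m := by rw [Finset.prod_const, Finset.card_univ, Fintype.card_fin]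
  have h2 : ∏ b, ‖v b‖ ≤ Real.sqrt S ^ m := by
    calc ∏ b, ‖v b‖ ≤ ∏ _b : Fin m, Real.sqrt S :=
          Finset.prod_le_prod (fun _ _ => norm_nonneg _) fun b _ => norm_gramB_le hD t (Z b)
      _ = Real.sqrt S ^ m := by rw [Finset.prod_const, Finset.card_univ, Fintype.card_fin]
  calc (∏ a, ‖u a‖) * ∏ b, ‖v b‖ ≤ Real.sqrt S ^ m * Real.sqrt S ^ m :=
        mul_le_mul h1 h2 (Finset.prod_nonneg fun _ _ => norm_nonneg _) (pow_nonneg (Real.sqrt_nonneg _) _)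
    _ = S ^ m := by rw [← mul_pow, Real.mul_self_sqrt hS]

end Gram

/-- **Lemma 2 of Salmhofer 1998 holds**: the named fact `CovarianceGramBound` (licence F-080) is a theorem.
[cite: Salmhofer1998, Lemma 2 (p.14 L126–142)] -/
theorem CovarianceGramBound_holds : CovarianceGramBound := by
  intro Λ _ _ Λs N _ _ _ χ neg εs Dhat M D hD t
  exact ⟨fun X X' => dform_antisymm hD t X X', fun i Y Z => norm_det_covMatrix_le hD t Y Z⟩

end Salmhofer1998

end Literature.MathematicalPhysics.QuantumLattice.FermiRG
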